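import Literature.Topology.FourManifolds.CappellShanesonHomotopySphereProofs
import Literature.AlgebraicTopology.SingularHomology.RelativeHomotopyInvariance
import Literature.AlgebraicTopology.SingularHomology.LocalHomologyIso
import Literature.AlgebraicTopology.SingularHomology.LocalHomologyCharts
import HarnessLib

/-!
# The 3-torus is `ℤ`-orientable: discharge of the named fact `Literature.Topology.FourManifolds.isOrientableOver_int_threeTorus`

`Literature.Topology.FourManifolds.PuncturedThreeTorusHomology` reduced the torus input
`Literature.Topology.FourManifolds.isIso_singularHomology_map_puncturedThreeTorusIncl` of Cappell–Shaneson
(Ann. of Math. 104 (1976), §2) to the orientability of `T³` (the named fact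
`Literature.Topology.FourManifolds.isOrientableOver_int_threeTorus`: `T³` carries a homological `ℤ`-orientation in dimension
`3`) plus the existence of fundamental classes. Here the orientability of `T³` is **proved**
(`Literature.Topology.FourManifolds.isOrientableOver_int_threeTorus_holds`).

The construction is the classical one for a topological group (A. Hatcher, *Algebraic Topology*
(2002), §3.3, p. 234: an orientation is a locally consistent choice of generators
`μₓ ∈ Hₙ(M | x)`; for a Lie group translate one generator around, cf. Lee, *Introduction to Smooth
Manifolds*, 2nd ed., Prop. 15.19 / Example 15.18 for the smooth version):

* `Literature.Topology.FourManifolds.localHomologyThreeTorusIso` — **`H₃(T³ | x; M) ≅ M`** (Hatcher 2002, §3.3, p. 231), from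
  `Literature.AlgebraicTopology.SingularHomology.localHomology.chartIso` and `Literature.AlgebraicTopology.SingularHomology.localHomologyRVecIso` (`Hₙ(ℝⁿ | p; M) ≅ M`, `n ≥ 2`) of
  `Literature.AlgebraicTopology.SingularHomology.LocalHomologyIso`;
* `Literature.ThreeTorus.translateLocal g : H₃(T³ | x) ⟶ H₃(T³ | g x)` — the map of pairs induced by the
  left translation `z ↦ g z` (`Homeomorph.mulLeft`), functorial in `g`, an isomorphism;
* `Literature.ThreeTorus.localGen x := (translate by x) μ₁` with `μ₁ ∈ H₃(T³ | 1; ℤ)` the generator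
  corresponding to `1 ∈ ℤ`; each `localGen x` is a generator (`localGenEquiv_localGen`);
* **local consistency** (`Literature.Topology.FourManifolds.ThreeTorus.restrictToPoint_eq_localGen`): on a good ball `B ∋ x`
  (`Literature.AlgebraicTopology.SingularHomology.exists_isOpen_forall_isIso_restrictToPoint`, proved in `…LocalHomologyCharts`) the class
  `μ_B` with `μ_B|ₓ = μₓ` restricts to `μ_y` at every `y` of a path-connected neighbourhood
  `W ⊆ B` of `x`: for a path `δ` from `y` to `x` in `W`, `F(t, z) = y (δ t)⁻¹ z` is a homotopy of
  maps of pairs `(T³, T³ ∖ B) → (T³, T³ ∖ y)` from the identity to the translation by `y x⁻¹`, so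
  `μ_B|_y = (y x⁻¹) • μ_B|ₓ = (y x⁻¹) • μₓ = μ_y` by the homotopy invariance of relative homology
  (Hatcher Prop. 2.19, proved in `…RelativeHomotopyInvariance`);
* `Literature.Topology.FourManifolds.ThreeTorus.homologicalOrientation`, **`Literature.Topology.FourManifolds.isOrientableOver_int_threeTorus_holds`**;
  consequently `Literature.Topology.FourManifolds.isIso_singularHomology_map_puncturedThreeTorusIncl_of_existsFundamentalClass`
  (the torus input of Cappell–Shaneson from the existence of fundamental classes alone) and
  **`Literature.Topology.FourManifolds.nonempty_homotopyEquiv_sphere_four_of_isCappellShanesonSphere_of_torusFacts''`**: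
  the Cappell–Shaneson target fact from exactly three named facts — (T1)
  `singularHomology_threeTorus_linear`, (F) `existsUnique_isFundamentalClass` for `T³`, (W)
  `SPC4.nonempty_homotopyEquiv_sphere_four_iff.{0}`.

Everything here is proved; the only new data are the isomorphisms, classes and the orientation
listed above.

## References

* A. Hatcher, *Algebraic Topology*, CUP 2002, §2.1 Prop. 2.19, Thm. 2.20; §3.3 pp. 231–236
  [HatcherAT2002].
* J. M. Lee, *Introduction to Smooth Manifolds*, 2nd ed., GTM 218, Springer 2013, Prop. 15.19,
  Example 15.18 [LeeSmoothManifolds2013].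
* S. E. Cappell, J. L. Shaneson, *Some new four-manifolds*, Ann. of Math. 104 (1976), §2
  [CappellShanesonAnnals1976].
-/

noncomputable section

open Set Function CategoryTheory Limits Topology
open scoped Manifold unitInterval

namespace Literature.Topology.FourManifolds

/-- Local notation: `𝔼 n` is the model Euclidean space `EuclideanSpace ℝ (Fin n)`. -/
local notation "𝔼 " n:arg => EuclideanSpace ℝ (Fin n)

/-! ### `H₃(T³ | x; M) ≅ M` -/

section LocalGroup

variable (R : Type) [CommRing R] (M : Type) [AddCommGroup M] [Module R M]

/-- **`H₃(T³ | x; M) ≅ M`** for every point of the 3-torus (Hatcher 2002, §3.3, p. 231: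
`Hₙ(M | x) ≅ Hₙ(ℝⁿ | 0)` by excision, `≅ M`), through the chart `Literature.threeTorusChart x`
(`Literature.AlgebraicTopology.SingularHomology.localHomology.chartIso`) and `Literature.AlgebraicTopology.SingularHomology.localHomologyRVecIso` of `…LocalHomologyIso`.
[cite: HatcherAT2002, §3.3 p. 231] -/
def localHomologyThreeTorusIso (x : ThreeTorus) : Literature.AlgebraicTopology.SingularHomology.localHomology R M ThreeTorus x 3 ≅ ModuleCat.of R M :=
  Literature.AlgebraicTopology.SingularHomology.localHomology.chartIso R M (threeTorusChart x) (mem_threeTorusChart_source x) 3 ≪≫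
    Literature.AlgebraicTopology.SingularHomology.localHomologyRVecIso R M 1 (threeTorusChart x x)

end LocalGroup

/-! ### Translating local homology classes around the group `T³` -/

namespace ThreeTorus

/-- Left translation by `g` sends `T³ ∖ {x}` into `T³ ∖ {y}` when `g x = y`. [folklore] -/
lemma mapsTo_mulLeft_compl {g x y : ThreeTorus} (h : g * x = y) :
    MapsTo (Homeomorph.mulLeft g : C(ThreeTorus, ThreeTorus)) ({x}ᶜ : Set ThreeTorus) {y}ᶜ := by
  intro z hz hzy
  apply hz
  have hzy : g * z = y := hzy
  rw [mem_singleton_iff]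
  exact mul_left_cancel (hzy.trans h.symm)

/-- **Translation on local homology**: for `g x = y`, the map `Hₙ(T³ | x; ℤ) ⟶ Hₙ(T³ | y; ℤ)`
induced by the map of pairs `z ↦ g z : (T³, T³ ∖ x) → (T³, T³ ∖ y)` (Hatcher 2002, §3.3: local
homology is functorial in maps of pairs). [folklore] -/
def translateLocal (g x y : ThreeTorus) (h : g * x = y) (n : ℕ) :
    Literature.AlgebraicTopology.SingularHomology.localHomology ℤ ℤ ThreeTorus x n ⟶ Literature.AlgebraicTopology.SingularHomology.localHomology ℤ ℤ ThreeTorus y n :=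
  Literature.AlgebraicTopology.SingularHomology.relativeSingularHomology.map ℤ ℤ (Homeomorph.mulLeft g : C(ThreeTorus, ThreeTorus))
    (mapsTo_mulLeft_compl h) n

/-- Translations compose: `(g' • ·) ∘ (g • ·) = (g' g • ·)` on local homology. [folklore] -/
@[reassoc]
lemma translateLocal_comp {g g' x y z : ThreeTorus} (h : g * x = y) (h' : g' * y = z) (n : ℕ) :
    translateLocal g x y h n ≫ translateLocal g' y z h' n =
      translateLocal (g' * g) x z (by rw [mul_assoc, h, h']) n := by
  rw [translateLocal, translateLocal, translateLocal, ← Literature.AlgebraicTopology.SingularHomology.relativeSingularHomology.map_comp]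
  exact Literature.AlgebraicTopology.SingularHomology.relativeSingularHomology.map.congr_simp ℤ ℤ _ _
    (ContinuousMap.ext fun w => (mul_assoc g' g w).symm) _ n

/-- Translation by `1` is the identity on local homology. [folklore] -/
lemma translateLocal_one (x : ThreeTorus) (h : 1 * x = x) (n : ℕ) :
    translateLocal 1 x x h n = 𝟙 _ := by
  rw [translateLocal, ← Literature.AlgebraicTopology.SingularHomology.relativeSingularHomology.map_id]
  exact Literature.AlgebraicTopology.SingularHomology.relativeSingularHomology.map.congr_simp ℤ ℤ _ _ (ContinuousMap.ext fun w => one_mul w) _ n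

/-- Translation by `g` followed by translation by `g⁻¹` is the identity. [folklore] -/
lemma translateLocal_comp_inv {g x y : ThreeTorus} (h : g * x = y) (n : ℕ) :
    translateLocal g x y h n ≫ translateLocal g⁻¹ y x (by rw [← h, inv_mul_cancel_left]) n = 𝟙 _ := by
  rw [translateLocal_comp]
  convert translateLocal_one x (one_mul x) n using 2
  exact inv_mul_cancel g

/-- **Translation is an isomorphism on local homology** (inverse: translation by `g⁻¹`). [folklore] -/
def translateLocalIso (g x y : ThreeTorus) (h : g * x = y) (n : ℕ) :
    Literature.AlgebraicTopology.SingularHomology.localHomology ℤ ℤ ThreeTorus x n ≅ Literature.AlgebraicTopology.SingularHomology.localHomology ℤ ℤ ThreeTorus y n where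
  hom := translateLocal g x y h n
  inv := translateLocal g⁻¹ y x (by rw [← h, inv_mul_cancel_left]) n
  hom_inv_id := translateLocal_comp_inv h n
  inv_hom_id := by
    rw [translateLocal_comp]
    convert translateLocal_one y (one_mul y) n using 2
    exact mul_inv_cancel g

/-! ### The local generators -/

/-- The reference generator `μ₁ ∈ H₃(T³ | 1; ℤ)`: the class corresponding to `1 ∈ ℤ` under
`Literature.Topology.FourManifolds.localHomologyThreeTorusIso` (Hatcher 2002, §3.3, p. 234, "local orientation"). [folklore] -/
def μOne : Literature.AlgebraicTopology.SingularHomology.localHomology ℤ ℤ ThreeTorus 1 3 := (localHomologyThreeTorusIso ℤ ℤ 1).inv (1 : ℤ)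

/-- **The local generator at `x`**: `μₓ := x • μ₁ ∈ H₃(T³ | x; ℤ)`, the translate of the reference
generator (Hatcher 2002, §3.3, p. 234; Lee 2013, Prop. 15.19: left-invariant orientations of a Lie
group). [cite: HatcherAT2002, §3.3 p. 234] -/
def localGen (x : ThreeTorus) : Literature.AlgebraicTopology.SingularHomology.localHomology ℤ ℤ ThreeTorus x 3 :=
  translateLocal x 1 x (mul_one x) 3 μOne

/-- Translating `μₓ` by `g` gives `μ_{g x}`. [folklore] -/
lemma translateLocal_localGen {g x y : ThreeTorus} (h : g * x = y) :
    translateLocal g x y h 3 (localGen x) = localGen y := by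
  subst h
  rw [localGen, localGen, ← ModuleCat.comp_apply, translateLocal_comp]

/-- A `ℤ`-linear identification `H₃(T³ | x; ℤ) ≃ₗ[ℤ] ℤ` taking `μₓ` to `1`: translate back to `1`
and apply `Literature.Topology.FourManifolds.localHomologyThreeTorusIso`. [folklore] -/
def localGenEquiv (x : ThreeTorus) : Literature.AlgebraicTopology.SingularHomology.localHomology ℤ ℤ ThreeTorus x 3 ≃ₗ[ℤ] ℤ :=
  ((translateLocalIso x⁻¹ x 1 (inv_mul_cancel x) 3) ≪≫ localHomologyThreeTorusIso ℤ ℤ 1).toLinearEquiv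

/-- `μₓ ↦ 1` under `localGenEquiv x`; in particular `μₓ` is a generator of `H₃(T³ | x; ℤ) ≅ ℤ`.
[folklore] -/
lemma localGenEquiv_localGen (x : ThreeTorus) : localGenEquiv x (localGen x) = 1 := by
  rw [localGenEquiv, Iso.toLinearEquiv_apply, Iso.trans_hom, ModuleCat.comp_apply]
  change (localHomologyThreeTorusIso ℤ ℤ 1).hom
    (translateLocal x⁻¹ x 1 (inv_mul_cancel x) 3 (localGen x)) = 1
  rw [translateLocal_localGen, localGen, translateLocal_one 1 (one_mul 1), ModuleCat.id_apply, μOne,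
    ← ModuleCat.comp_apply, Iso.inv_hom_id, ModuleCat.id_apply]

/-! ### Local consistency from homotopy invariance -/

/-- The homotopy `F(t, z) = y (δ t)⁻¹ z` along a path `δ` from `y` to `x`, from the identity
(`t = 0`) to the translation by `y x⁻¹` (`t = 1`). [folklore] -/
def translationHomotopy {x y : ThreeTorus} (δ : Path y x) :
    ContinuousMap.Homotopy (ContinuousMap.id ThreeTorus)
      (Homeomorph.mulLeft (y * x⁻¹) : C(ThreeTorus, ThreeTorus)) where
  toFun tz := y * (δ tz.1)⁻¹ * tz.2
  continuous_toFun := by fun_prop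
  map_zero_left z := by simp
  map_one_left z := by simp

/-- **Local consistency of the translated generators** (Hatcher 2002, §3.3, p. 234, the "local
consistency condition", here for the classes `μₓ = x • μ₁` of the group `T³`): if `B ∋ x` is a
good ball (restriction
`H₃(T³ | B) → H₃(T³ | x)` an isomorphism), `μ_B` the class with `μ_B|ₓ = μₓ`, and `W ⊆ B` a
path-connected set containing `x`, then `μ_B|_y = μ_y` for every `y ∈ W`: along a path `δ` from
`y` to `x` in `W`, `F(t, z) = y (δ t)⁻¹ z` is a homotopy of maps of pairs
`(T³, T³ ∖ B) → (T³, T³ ∖ y)` from the identity to the translation by `y x⁻¹`, so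
`μ_B|_y = (y x⁻¹) • (μ_B|ₓ) = (y x⁻¹) • μₓ = μ_y` by the homotopy invariance of relative homology
(Hatcher Prop. 2.19, `relativeSingularHomology.map_eq_of_homotopic_holds`).
[cite: HatcherAT2002, §3.3 p. 234] -/
theorem restrictToPoint_eq_localGen {B W : Set ThreeTorus} {x : ThreeTorus} (hxB : x ∈ B)
    [IsIso (Literature.AlgebraicTopology.SingularHomology.restrictToPoint ℤ ℤ hxB 3)] (hWB : W ⊆ B) (hW : IsPathConnected W) (hxW : x ∈ W)
    {y : ThreeTorus} (hyW : y ∈ W) :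
    Literature.AlgebraicTopology.SingularHomology.restrictToPoint ℤ ℤ (hWB hyW) 3 (inv (Literature.AlgebraicTopology.SingularHomology.restrictToPoint ℤ ℤ hxB 3) (localGen x)) = localGen y := by
  set μB := inv (Literature.AlgebraicTopology.SingularHomology.restrictToPoint ℤ ℤ hxB 3) (localGen x) with hμB
  have hμBx : Literature.AlgebraicTopology.SingularHomology.restrictToPoint ℤ ℤ hxB 3 μB = localGen x := by
    rw [hμB, ← ModuleCat.comp_apply, IsIso.inv_hom_id, ModuleCat.id_apply]
  -- a path from `y` to `x` inside `W`
  let δ : Path y x := (hW.joinedIn y hyW x hxW).somePath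
  have hδ : ∀ t, δ t ∈ W := (hW.joinedIn y hyW x hxW).somePath_mem
  -- the homotopy is a homotopy of maps of pairs `(T³, T³ ∖ B) → (T³, T³ ∖ y)`
  have hF : ∀ tz : I × ThreeTorus, tz.2 ∈ (Bᶜ : Set ThreeTorus) →
      translationHomotopy δ tz ∈ ({y}ᶜ : Set ThreeTorus) := by
    rintro ⟨t, z⟩ hz hzy
    apply hz
    have hzy : y * (δ t)⁻¹ * z = y := hzy
    have : z = δ t := by
      have e := congrArg (fun w => δ t * (y⁻¹ * w)) hzy
      simpa [mul_assoc] using e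
    rw [this]
    exact hWB (hδ t)
  have h0 : MapsTo (ContinuousMap.id ThreeTorus) (Bᶜ : Set ThreeTorus) ({y}ᶜ : Set ThreeTorus) :=
    fun z hz hzy => hz (by
      have hzy' : z = y := hzy
      exact hzy' ▸ hWB hyW)
  have h1 : MapsTo (Homeomorph.mulLeft (y * x⁻¹) : C(ThreeTorus, ThreeTorus)) (Bᶜ : Set ThreeTorus)
      ({y}ᶜ : Set ThreeTorus) := fun z hz hzy => by
    apply hz
    have hzy : y * x⁻¹ * z = y := hzy
    have : z = x := by
      have e := congrArg (fun w => x * (y⁻¹ * w)) hzy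
      simpa [mul_assoc] using e
    rw [this]
    exact hxB
  have key := Literature.AlgebraicTopology.SingularHomology.relativeSingularHomology.map_eq_of_homotopic_holds ℤ ℤ
    (X := ThreeTorus) (Y := ThreeTorus) h0 h1 (translationHomotopy δ) hF 3
  -- `map id = restrictToPoint y`, `map (translation) = restrictToPoint x ≫ translateLocal`
  have hL : Literature.AlgebraicTopology.SingularHomology.relativeSingularHomology.map ℤ ℤ (ContinuousMap.id ThreeTorus) h0 3 =
      Literature.AlgebraicTopology.SingularHomology.restrictToPoint ℤ ℤ (hWB hyW) 3 := rfl
  have hR : Literature.AlgebraicTopology.SingularHomology.relativeSingularHomology.map ℤ ℤ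
      (Homeomorph.mulLeft (y * x⁻¹) : C(ThreeTorus, ThreeTorus)) h1 3 =
      Literature.AlgebraicTopology.SingularHomology.restrictToPoint ℤ ℤ hxB 3 ≫ translateLocal (y * x⁻¹) x y (by rw [inv_mul_cancel_right]) 3 := by
    rw [Literature.AlgebraicTopology.SingularHomology.restrictToPoint, Literature.AlgebraicTopology.SingularHomology.restrictLocal, translateLocal, ← Literature.AlgebraicTopology.SingularHomology.relativeSingularHomology.map_comp]
    rfl
  rw [← hL, key, hR, ModuleCat.comp_apply, hμBx, translateLocal_localGen]

/-! ### The orientation -/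

/-- **A homological `ℤ`-orientation of `T³`** (Hatcher 2002, §3.3, p. 234; Lee 2013,
Prop. 15.19 / Example 15.18): the translated generators `μₓ = x • μ₁`, which are generators
(`localGenEquiv_localGen`) and locally consistent (`restrictToPoint_eq_localGen` on a
path-connected neighbourhood inside a good ball, `Literature.AlgebraicTopology.SingularHomology.exists_isOpen_forall_isIso_restrictToPoint`).
[cite: HatcherAT2002, §3.3 p. 234] -/
def homologicalOrientation : Literature.AlgebraicTopology.SingularHomology.HomologicalOrientation ℤ ThreeTorus 3 where
  localClass := localGen
  isGenerator x := ⟨localGenEquiv x, localGenEquiv_localGen x⟩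
  locallyConsistent x := by
    letI := threeTorusChartedSpaceFinThree
    haveI : LocallyPathConnectedSpace ThreeTorus :=
      ChartedSpace.locallyPathConnectedSpace (𝔼 3) ThreeTorus
    obtain ⟨B, hxB, hBo, -, hB⟩ :=
      Literature.AlgebraicTopology.SingularHomology.exists_isOpen_forall_isIso_restrictToPoint ℤ ℤ (𝔼 3) x Filter.univ_mem
    obtain ⟨W, ⟨hWn, hWpc⟩, hWB⟩ := (path_connected_basis x).mem_iff.mp (hBo.mem_nhds hxB)
    change W ⊆ B at hWB
    haveI := hB x hxB 3
    refine ⟨W, hWn, Literature.AlgebraicTopology.SingularHomology.restrictLocal ℤ ℤ hWB 3 (inv (Literature.AlgebraicTopology.SingularHomology.restrictToPoint ℤ ℤ hxB 3) (localGen x)),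
      fun y hy => ?_⟩
    rw [Literature.AlgebraicTopology.SingularHomology.restrictToPoint_restrictLocal_apply]
    exact restrictToPoint_eq_localGen hxB hWB hWpc (mem_of_mem_nhds hWn) hy

end ThreeTorus

/-- **The 3-torus is `ℤ`-orientable — discharge of the named fact
`Literature.Topology.FourManifolds.isOrientableOver_int_threeTorus`** (Lee 2013, Example 15.18 / Prop. 15.19; Hatcher 2002, §3.3,
p. 234): the left-invariant family of local generators `Literature.Topology.FourManifolds.ThreeTorus.homologicalOrientation`.
[cite: LeeSmoothManifolds2013, Example 15.18] -/
theorem isOrientableOver_int_threeTorus_holds : isOrientableOver_int_threeTorus :=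
  ⟨ThreeTorus.homologicalOrientation⟩

/-- **The torus input of Cappell–Shaneson from the existence of fundamental classes**: the
puncture comparison `Literature.Topology.FourManifolds.isIso_singularHomology_map_puncturedThreeTorusIncl` (`T³ ∖ 1 ↪ T³` is an
isomorphism on `H₁`, `H₂` with integer coefficients) follows from the general named fact
`Literature.AlgebraicTopology.SingularHomology.existsUnique_isFundamentalClass` (Hatcher Thm. 3.26(a) / Lemma 3.27(a)) for `T³` alone
(Cappell–Shaneson 1976, §2). [cite: CappellShanesonAnnals1976, §2] -/
theorem isIso_singularHomology_map_puncturedThreeTorusIncl_of_existsFundamentalClass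
    (hF : @Literature.AlgebraicTopology.SingularHomology.existsUnique_isFundamentalClass ℤ _ ThreeTorus _ 3) :
    isIso_singularHomology_map_puncturedThreeTorusIncl :=
  isIso_singularHomology_map_puncturedThreeTorusIncl_of_isOrientable
    isOrientableOver_int_threeTorus_holds hF

section SPC4

universe u

/-- **Cappell–Shaneson spheres are homotopy 4-spheres, from the three remaining named facts**
(every universe): the target fact `nonempty_homotopyEquiv_sphere_four_of_isCappellShanesonSphere`
(Cappell–Shaneson, Ann. of Math. 104 (1976), §2) follows from (T1) the homology of `T³` with its
`SL(3, ℤ)`-action (`singularHomology_threeTorus_linear`, Hatcher §3.C Ex. 11), (F) the existence of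
fundamental classes for `T³` (`existsUnique_isFundamentalClass`, Hatcher Thm. 3.26(a)) and (W) the
recognition of homotopy 4-spheres at universe `0` (`nonempty_homotopyEquiv_sphere_four_iff`);
the fundamental group, excision, Mayer–Vietoris, the homology of spheres, the local homology and
orientation of `T³`, the homotopy invariance of relative homology and the injectivity half of
Thm. 3.26 are theorems of the tree. [cite: CappellShanesonAnnals1976, §2] -/
theorem nonempty_homotopyEquiv_sphere_four_of_isCappellShanesonSphere_of_torusFacts''
    (hT1 : singularHomology_threeTorus_linear)
    (hF : @Literature.AlgebraicTopology.SingularHomology.existsUnique_isFundamentalClass ℤ _ ThreeTorus _ 3)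
    (hW : nonempty_homotopyEquiv_sphere_four_iff.{0})
    (X : Type u) [TopologicalSpace X] [ChartedSpace (𝔼 4) X] :
    nonempty_homotopyEquiv_sphere_four_of_isCappellShanesonSphere X :=
  nonempty_homotopyEquiv_sphere_four_of_isCappellShanesonSphere_of_torusFacts hT1
    isOrientableOver_int_threeTorus_holds hF hW X

end SPC4

end Literature.Topology.FourManifolds
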